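import Summits.QuantumFields.YangMills.Theorems.FlatTubeReductionFibreKernelLevelWeight
import Summits.QuantumFields.YangMills.Theorems.FlatTubeReductionLevelWeightRestrict
import HarnessLib

/-!
# The fibre kernel with the gauge-deviation weight is a bounded multiple of the reference mass

Support file for the crux `NearFlatRatioLaw` (line `ratepack_v2`, stub `stub_hODpot_A`, step (R3b-iii) of
`Cruxes/NearFlatRatioLaw/Lines/ratepack-v7-moments-g18.md` §10).

Composition of `…FibreKernelLevelWeight.fpBOKernel_gaugeDev_le_levelWeight` (gauge-deviation weight ≤ level weight),
`…LevelWeightRestrict.integral_levelWeight_pow_le_setIntegral_four` (powers `j ≤ 4`, restriction to the bounded-level set) and the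
g12 reference-moment theorem `RateTube.profile_moment_number` (fourth level moment ≤ `Ξ₀ ×` reference mass, given the Gaussian profile
numbers of the reweighted profile): for `β ≥ 900`, `βε² ≤ 1`, a profile `Ω′` supported in the capped balanced set with `‖x̂‖ ≤ R ≤ 1`
and satisfying the two profile-number inequalities with constant `A` on a fibre core `C`,
`fpBOKernel β Ω′ (coreWeight ε R₁·(1+βG)^j) 1 1 ≤ Ξ₁(A)·fpBOKernel β Ω′ (fpWeight ε) 1 1` (`fpBOKernel_gaugeDev_le_reference_mass`) —
the fibre factors of the `(C2)`-moments chain are reference masses of reweighted profiles (profile numbers only, no logarithm).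
-/

noncomputable section

open MeasureTheory Filter Topology Real
open scoped BigOperators
open Literature.MathematicalPhysics.QuantumFieldTheory
open Literature.MathematicalPhysics.QuantumLattice

namespace Summit.QuantumFields.YangMills.Theorems.FemtoTransferGap.TwoLattice.ConstTube

open Summit.QuantumFields.YangMills.Theorems.FemtoTransferGap
open Summit.QuantumFields.YangMills.Theorems.FemtoTransferGap.TwoLattice
open Summit.QuantumFields.YangMills.Theorems.FemtoTransferGap.TwoLattice.Avg
open Summit.QuantumFields.YangMills.Theorems.FemtoTransferGap.TwoLattice.Stiff (LinkSpace)

variable {L : ℕ} [NeZero L]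

/-- The level-weighted reference integrand `fpTriple·(1 + β·kin + β‖x‖² + β‖x′‖²)^n` is integrable (bounded measurable: the profile lives
on `‖x̂‖ ≤ R` and `kinDefect ≤ 4|E|`). [folklore] -/
theorem integrable_fpTriple_mul_levelWeight_pow {β ε : ℝ} (hβ : 0 ≤ β) {Ω' : LinkSpace L → ℝ} (hΩm : Measurable Ω') {CΩ : ℝ} (hCΩ : ∀ x, |Ω' x| ≤ CΩ)
    {R : ℝ} (hΩt : ∀ v : Edge 3 L → Fin 3 → ℝ, Ω' (linkEmbed L v) ≠ 0 → v ∈ capBalancedSet L ∧ ‖linkEmbed L v‖ ≤ R) (n : ℕ) :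
    Integrable (fun p : (Edge 3 L → Fin 3 → ℝ) × ((Edge 3 L → Fin 3 → ℝ) × (Site 3 L → SU2)) =>
      fpTriple L β Ω' (fpWeight L ε) 1 1 p * (1 + β * kinDefect L (orthoTube L 1 p.1) (orthoTube L 1 p.2.1) p.2.2 + β * ‖linkEmbed L p.1‖ ^ 2 + β * ‖linkEmbed L p.2.1‖ ^ 2) ^ n)
      ((orthoTransverse L).prod ((orthoTransverse L).prod (gaugeMeasure L))) := by
  haveI : SecondCountableTopology SU2 := secondCountableTopology_su2
  haveI := isFiniteMeasure_orthoTransverse L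
  have hNm' := (RateTube.continuous_kinDefect_joint (L := L)).measurable.comp
    (((measurable_orthoTube_right (L := L) 1).comp measurable_fst).prodMk
      (((measurable_orthoTube_right (L := L) 1).comp (measurable_fst.comp measurable_snd)).prodMk (measurable_snd.comp measurable_snd)))
  have hlevm : Measurable fun p : (Edge 3 L → Fin 3 → ℝ) × ((Edge 3 L → Fin 3 → ℝ) × (Site 3 L → SU2)) =>
      1 + β * kinDefect L (orthoTube L 1 p.1) (orthoTube L 1 p.2.1) p.2.2 + β * ‖linkEmbed L p.1‖ ^ 2 + β * ‖linkEmbed L p.2.1‖ ^ 2 := by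
    refine ((measurable_const.add ?_).add ?_).add ?_
    · have h := hNm'.const_mul β; simpa only [Function.comp_def] using h
    · exact (((measurable_linkEmbed L).comp measurable_fst).norm.pow_const 2).const_mul β
    · exact (((measurable_linkEmbed L).comp (measurable_fst.comp measurable_snd)).norm.pow_const 2).const_mul β
  obtain ⟨B, hB⟩ := abs_fpTriple_le (L := L) β hCΩ (abs_fpWeight_le L ε) 1 1
  have hB0 : 0 ≤ B := (abs_nonneg _).trans (hB (0, (0, 1)))
  refine integrable_of_measurable_abs_le _ ((measurable_fpTriple β hΩm (measurable_fpWeight L ε) 1 1).mul (hlevm.pow_const n))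
    (C := B * (1 + β * (4 * Fintype.card (Edge 3 L)) + β * R ^ 2 + β * R ^ 2) ^ n) fun p => ?_
  have hkin0 := kinDefect_nonneg (L := L) (orthoTube L 1 p.1) (orthoTube L 1 p.2.1) p.2.2
  have hlev0 : 0 ≤ 1 + β * kinDefect L (orthoTube L 1 p.1) (orthoTube L 1 p.2.1) p.2.2 + β * ‖linkEmbed L p.1‖ ^ 2 + β * ‖linkEmbed L p.2.1‖ ^ 2 := by positivity
  rw [abs_mul, abs_of_nonneg (pow_nonneg hlev0 n)]
  by_cases h1 : Ω' (linkEmbed L p.1) = 0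
  · have : fpTriple L β Ω' (fpWeight L ε) 1 1 p = 0 := by unfold fpTriple; rw [h1, zero_mul]
    rw [this, abs_zero, zero_mul]; exact mul_nonneg hB0 (pow_nonneg (by positivity) n)
  by_cases h2 : Ω' (linkEmbed L p.2.1) = 0
  · have : fpTriple L β Ω' (fpWeight L ε) 1 1 p = 0 := by unfold fpTriple; rw [h2, mul_zero, mul_zero]
    rw [this, abs_zero, zero_mul]; exact mul_nonneg hB0 (pow_nonneg (by positivity) n)
  have hR0 : 0 ≤ R := (norm_nonneg _).trans (hΩt p.1 h1).2
  have hx1 : ‖linkEmbed L p.1‖ ^ 2 ≤ R ^ 2 := pow_le_pow_left₀ (norm_nonneg _) (hΩt p.1 h1).2 2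
  have hx2 : ‖linkEmbed L p.2.1‖ ^ 2 ≤ R ^ 2 := pow_le_pow_left₀ (norm_nonneg _) (hΩt p.2.1 h2).2 2
  have hk := kinDefect_le_four_card (L := L) (orthoTube L 1 p.1) (orthoTube L 1 p.2.1) p.2.2
  have hle : 1 + β * kinDefect L (orthoTube L 1 p.1) (orthoTube L 1 p.2.1) p.2.2 + β * ‖linkEmbed L p.1‖ ^ 2 + β * ‖linkEmbed L p.2.1‖ ^ 2 ≤
      1 + β * (4 * Fintype.card (Edge 3 L)) + β * R ^ 2 + β * R ^ 2 := by
    have := mul_le_mul_of_nonneg_left hk hβ; have := mul_le_mul_of_nonneg_left hx1 hβ; have := mul_le_mul_of_nonneg_left hx2 hβ; linarith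
  exact mul_le_mul (hB p) (pow_le_pow_left₀ hlev0 hle n) (pow_nonneg hlev0 n) hB0

/-- ★★★ **THE FIBRE KERNEL WITH THE GAUGE-DEVIATION WEIGHT ≤ Ξ₁ × THE REFERENCE MASS** (see the module docstring): with the constant
`Ξ₁ = C_L⁴·Ξ₀(A)` of `RateTube.profile_moment_number`. [cite: Luscher1983, §3] -/
theorem fpBOKernel_gaugeDev_le_reference_mass {A : ℝ} (hA : 0 ≤ A) :
    ∃ Ξ₁ : ℝ, 0 ≤ Ξ₁ ∧ ∀ {β : ℝ}, 900 ≤ β → ∀ {Ω' : LinkSpace L → ℝ}, Measurable Ω' → ∀ {CΩ : ℝ}, (∀ x, |Ω' x| ≤ CΩ) → (∀ x, 0 ≤ Ω' x) → ∀ {R : ℝ}, R ≤ 1 →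
      (∀ v : Edge 3 L → Fin 3 → ℝ, Ω' (linkEmbed L v) ≠ 0 → v ∈ capBalancedSet L ∧ ‖linkEmbed L v‖ ≤ R) → ∀ {ε : ℝ}, 0 < ε → β * ε ^ 2 ≤ 1 →
      ∀ {C : Set (Edge 3 L → Fin 3 → ℝ)}, MeasurableSet C →
      (∀ v ∈ C, v ∈ capBalancedSet L ∧ ‖linkEmbed L v‖ ≤ (Real.sqrt β)⁻¹ ∧ ∀ (e : Edge 3 L) (c : Fin 3), |v e c| ≤ (Real.sqrt β)⁻¹) →
      0 < ∫ v in C, Ω' (linkEmbed L v) ∂orthoTransverse L →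
      ∫ v, Ω' (linkEmbed L v) * (1 + β * ‖linkEmbed L v‖ ^ 2) ^ 4 ∂orthoTransverse L ≤ A * ∫ v in C, Ω' (linkEmbed L v) ∂orthoTransverse L →
      ∫ v, Ω' (linkEmbed L v) * (1 + β * ‖linkEmbed L v‖ ^ 2) ^ 4 * (Real.sqrt β * ‖linkEmbed L v‖) ^ (3 * Fintype.card {x : Site 3 L // ¬x = 0}) ∂orthoTransverse L ≤
        A * ∫ v in C, Ω' (linkEmbed L v) ∂orthoTransverse L →
      ∀ (R₁ : ℝ) {j : ℕ}, j ≤ 4 →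
      fpBOKernel L β Ω' (fun g => coreWeight L ε R₁ g * (1 + β * ∑ y, ‖su2Quat (g y) - 1‖ ^ 2) ^ j) 1 1 ≤
        Ξ₁ * fpBOKernel L β Ω' (fpWeight L ε) 1 1 := by
  obtain ⟨Ξ₀, hΞ₀, hPM⟩ := RateTube.profile_moment_number (L := L) hA
  set CL : ℝ := 1 + (Fintype.card (Site 3 L) : ℝ) * (24300 * (L : ℝ) ^ 2 + 2) with hCL
  have hCL1 : 1 ≤ CL := by
    have h0 : (0 : ℝ) ≤ (Fintype.card (Site 3 L) : ℝ) * (24300 * (L : ℝ) ^ 2 + 2) := by positivity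
    rw [hCL]; linarith
  refine ⟨CL ^ 4 * Ξ₀, mul_nonneg (pow_nonneg (zero_le_one.trans hCL1) 4) hΞ₀, ?_⟩
  intro β hβ Ω' hΩm CΩ hCΩ hΩ0 R hR1 hΩt ε hε hβε C hC hCsub hθ hn1 hn2 R₁ j hj
  have hβ0 : (0 : ℝ) ≤ β := by linarith
  -- the three steps
  have h1 := fpBOKernel_gaugeDev_le_levelWeight (L := L) (R₁ := R₁) hβ0 hβε hΩm hCΩ hΩ0 hR1 hΩt j
    (integrable_fpTriple_mul_levelWeight_pow hβ0 hΩm hCΩ hΩt j)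
  have hR0 : 0 ≤ β * R ^ 2 := mul_nonneg hβ0 (sq_nonneg _)
  have hE0 : 0 ≤ β * (4 * Fintype.card (Edge 3 L)) := by positivity
  have h2 := integral_levelWeight_pow_le_setIntegral_four (L := L) (ε := ε) hβ0 hΩ0 hΩt hj (T := β * (4 * Fintype.card (Edge 3 L)) + β * R ^ 2)
    (by linarith) (by linarith) (integrable_fpTriple_mul_levelWeight_pow hβ0 hΩm hCΩ hΩt 4)
  have h3 := hPM hβ hΩm hCΩ hΩ0 hΩt hε hC hCsub hθ hn1 hn2 (β * (4 * Fintype.card (Edge 3 L)) + β * R ^ 2)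
  have h4 : ∫ p, fpTriple L β Ω' (fpWeight L ε) 1 1 p ∂((orthoTransverse L).prod ((orthoTransverse L).prod (gaugeMeasure L))) = fpBOKernel L β Ω' (fpWeight L ε) 1 1 :=
    (fpBOKernel_eq_integral_prod β hΩm hCΩ (measurable_fpWeight L ε) (abs_fpWeight_le L ε) 1 1).symm
  rw [h4] at h3
  have hK0 : 0 ≤ fpBOKernel L β Ω' (fpWeight L ε) 1 1 := by
    rw [← h4]
    exact integral_nonneg fun p => by
      unfold fpTriple
      exact mul_nonneg (hΩ0 _) (mul_nonneg (mul_nonneg (fpWeight_mem_Icc L ε p.2.2).1 (transferKernel_pos su2Rep β _ _).le) (hΩ0 _))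
  have hCj : CL ^ j ≤ CL ^ 4 := pow_le_pow_right₀ hCL1 hj
  have hCj0 : 0 ≤ CL ^ j := pow_nonneg (zero_le_one.trans hCL1) j
  rw [← hCL] at h1
  calc fpBOKernel L β Ω' (fun g => coreWeight L ε R₁ g * (1 + β * ∑ y, ‖su2Quat (g y) - 1‖ ^ 2) ^ j) 1 1
      ≤ CL ^ j * ∫ p, fpTriple L β Ω' (fpWeight L ε) 1 1 p *
          (1 + β * kinDefect L (orthoTube L 1 p.1) (orthoTube L 1 p.2.1) p.2.2 + β * ‖linkEmbed L p.1‖ ^ 2 + β * ‖linkEmbed L p.2.1‖ ^ 2) ^ j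
          ∂((orthoTransverse L).prod ((orthoTransverse L).prod (gaugeMeasure L))) := h1
    _ ≤ CL ^ j * (Ξ₀ * fpBOKernel L β Ω' (fpWeight L ε) 1 1) := mul_le_mul_of_nonneg_left (h2.trans h3) hCj0
    _ ≤ CL ^ 4 * (Ξ₀ * fpBOKernel L β Ω' (fpWeight L ε) 1 1) := mul_le_mul_of_nonneg_right hCj (mul_nonneg hΞ₀ hK0)
    _ = CL ^ 4 * Ξ₀ * fpBOKernel L β Ω' (fpWeight L ε) 1 1 := by ring

end Summit.QuantumFields.YangMills.Theorems.FemtoTransferGap.TwoLattice.ConstTube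

end
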